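import Mathlib.Analysis.Fourier.ZMod
import Mathlib.Algebra.BigOperators.Group.Finset.Basic
import Mathlib.Algebra.Group.Subgroup.Basic
import Mathlib.Data.ZMod.Basic
import Mathlib.Tactic.Ring
import Mathlib.Tactic.Linarith
import Mathlib.Tactic.FinCases
import Mathlib.Tactic.IntervalCases
import HarnessLib

/-!
# Named Weil 4-folds in Hecke pieces: the algebraic skeleton of THEOREM Y (WEIL-2 gen 59, HECKE-G59, fact-free)

research route, not a corollary; conditional on HC_CM plus one named minimal statement.

Cell `pub-hodge-ring2-ab-*` (ALL ABELIAN VARIETIES), seat WEIL-2 gen 59, account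
`run/shared/lean/pub/pub-hodge-ring2/pub-hodge-ring2-ab-weil-2/HECKE-G59.md` (THEOREM Y, EXAMPLE Y″), WEIL-CELLS §R69.

Informal setting (HECKE-G59 §1–§3).  `C̃` a curve with `N = ℤ/m ⊂ Aut C̃` and SIMPLE branch data (Schoen 1988, Thm 2.0),
`𝔓 ⊂ J(C̃)` the `N`-primitive Prym, `A = e_H 𝔓` a Hecke piece (`G = N ⋊ H`, `H = ker χ_K`, `K` imaginary quadratic),
`ψ = e_H ∘ pr_𝔓 ∘ Φ : C̃^h → A`.  THEOREM Y: for Schoen's `m` components `Q_t` and a generator `w` of the Weil line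
`∧^h V₊(A)`, the function `F_w(t) = ⟨ψ_* π^*[Q_t], w⟩` on `ℤ/m` has Fourier transform supported on ONE `H`-orbit of
primitive characters with NON-ZERO coefficients there; hence some `Q_t` maps to a named 4-fold with non-zero Weil part.
The geometric inputs (Schoen's theorem, Künneth, Poincaré duality) are not formalised; this file proves the finite,
algebraic steps the account isolates:
* LEMMA Y1 (character support): a character `(a_i)` of `N^h` that kills `ker(Σ : N^h → N)` is DIAGONAL, and conversely
  (`diagonal_of_vanishing_on_kerSum`, `vanishing_on_kerSum_of_diagonal`);
* LEMMA Y3 (isotropy): if `ε ∉ H` (`ε = −1`, `χ_K` odd) then the orbits `H·a` and `ε·H·a` are disjoint (`ne_twist_of_not_mem`);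
* LEMMA Y0 (Weil part by pairing): the bidegree bookkeeping `(a,b) + (a′,b′) = (h,h)`, `(a′,b′) ∈ {(h,0),(0,h)}` forces
  `(a,b) ∈ {(0,h),(h,0)}` (`weilPart_detected_in_top_bidegree`);
* ASSEMBLY (i)/(iii): on `ℤ/N`, a function with a non-zero spectrum is non-zero somewhere, and a function whose
  transform vanishes at `0` has sum zero (`exists_apply_ne_zero_of_spectrum_ne_zero`, `sum_eq_zero_of_dft_zero`; Mathlib's
  `ZMod.dft` is a linear equivalence);
* EXAMPLE Y″ (the two headline families at level 12): the involution classes of `ℤ/12 ⋊ ⟨5⟩` and `ℤ/12 ⋊ ⟨7⟩`, the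
  coboundary subgroups, the fixed-point criterion and the zero counts `4 ∕ 0` resp. `0 ∕ 6` of the twisted-period
  exponent equation, all by `decide` over `ZMod 12`; and the parity sums of the headline class multisets.

0 sorry, no `def`, no named fact; `HC_CM` does not occur.
-/

namespace Summit.HodgeConjecture.Ring2AbelianAll.HeckeNamedFourfolds

open Finset

section characterSupport

variable {ι R : Type*} [Fintype ι] [DecidableEq ι] [CommRing R]

/-- **LEMMA Y1 (character support), skeleton.**  Encode a character of `N^h` by exponents `a : ι → R` (so that it takes
the value `ζ^{Σ a_i t_i}` on `t`) — if it is trivial on `ker(Σ : N^h → N)`, i.e. `Σ_i a_i t_i = 0` whenever `Σ_i t_i = 0`,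
then it is DIAGONAL: all `a_i` are equal (test on `t = e_i − e_j`).  This is why the `χ`-eigenspaces (`χ ≠ 1`) of
`H^h(W₀)` are purely of Künneth type `(1,…,1)` with every factor in the SAME eigenspace.  [locator HECKE-G59 §3 LEMMA Y1]
research route, not a corollary; conditional on HC_CM plus one named minimal statement. -/
theorem diagonal_of_vanishing_on_kerSum (a : ι → R)
    (h : ∀ t : ι → R, ∑ i, t i = 0 → ∑ i, a i * t i = 0) (i j : ι) : a i = a j := by
  have key := h (fun k => (if k = i then (1 : R) else 0) - (if k = j then (1 : R) else 0)) (by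
    simp only [Finset.sum_sub_distrib, Finset.sum_ite_eq', Finset.mem_univ, if_true, sub_self])
  simp only [mul_sub, Finset.sum_sub_distrib, mul_ite, mul_one, mul_zero, Finset.sum_ite_eq',
    Finset.mem_univ, if_true] at key
  exact sub_eq_zero.mp key

omit [DecidableEq ι] in
/-- **LEMMA Y1, converse.**  A diagonal character `(c,…,c)` kills `ker Σ`.  [locator HECKE-G59 §3 LEMMA Y1]
research route, not a corollary; conditional on HC_CM plus one named minimal statement. -/
theorem vanishing_on_kerSum_of_diagonal (a : ι → R) (c : R) (ha : ∀ i, a i = c)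
    (t : ι → R) (ht : ∑ i, t i = 0) : ∑ i, a i * t i = 0 := by
  simp only [ha, ← Finset.mul_sum, ht, mul_zero]

end characterSupport

section isotropy

variable {G : Type*} [Group G]

/-- **LEMMA Y3 (isotropy), skeleton.**  In the character group `(ℤ/f)^×` let `H` be a subgroup not containing
`ε` (`ε = −1`; `−1 ∉ ker χ_K` because the quadratic character of an imaginary quadratic field is odd).  Then no element
of the orbit `H·a` equals `ε` times an element of `H·a`: the two `H`-orbits `O₊ = H·a` and `O₋ = ε·H·a` of primitive
characters are DISJOINT, so the cup product vanishes identically on `⊕_{χ ∈ O₊} V_χ` (it pairs `V_χ` with `V_{χ̄}`,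
`χ̄ = ε·χ`).  [locator HECKE-G59 §3 LEMMA Y3]
research route, not a corollary; conditional on HC_CM plus one named minimal statement. -/
theorem ne_twist_of_not_mem (H : Subgroup G) (ε : G) (hε : ε ∉ H) (a : G) {u v : G}
    (hu : u ∈ H) (hv : v ∈ H) : u * a ≠ ε * (v * a) := by
  intro h
  have h' : u = ε * v := mul_right_cancel (by rwa [mul_assoc])
  have hεeq : ε = u * v⁻¹ := by rw [h', mul_inv_cancel_right]
  exact hε (hεeq ▸ H.mul_mem hu (H.inv_mem hv))

/-- **LEMMA Y3, the group-theoretic reason `−1 ∉ H`:** an element of order two that is not in `H` — stated as: if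
`ε ∉ H` then `ε·u ∉ H` for every `u ∈ H` (the coset `εH` is disjoint from `H`).  [locator HECKE-G59 §1 (e)]
research route, not a corollary; conditional on HC_CM plus one named minimal statement. -/
theorem twist_not_mem (H : Subgroup G) (ε : G) (hε : ε ∉ H) {u : G} (hu : u ∈ H) : ε * u ∉ H := by
  intro h
  apply hε
  have : ε = (ε * u) * u⁻¹ := by rw [mul_inv_cancel_right]
  rw [this]
  exact H.mul_mem h (H.inv_mem hu)

end isotropy

section weilPart

/-- **LEMMA Y0 (the Weil part is detected by pairing with the Weil line), bookkeeping.**  The `K^×`-bidegrees on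
`H^h(A)` are `(a,b)` with `a + b = h`; the cup-product pairing into `H^{2h}` (bidegree `(h,h)`) pairs `(a,b)` only with
`(h − a, h − b)`.  Hence a class pairing non-trivially with the Weil line `(h,0) ⊕ (0,h)` has a component of bidegree
`(0,h)` or `(h,0)` — a non-zero Weil part — and conversely.  [locator HECKE-G59 §3 LEMMA Y0]
research route, not a corollary; conditional on HC_CM plus one named minimal statement. -/
theorem weilPart_detected_in_top_bidegree (h a b a' b' : ℕ) (hab : a + b = h)
    (hsum₁ : a + a' = h) (hsum₂ : b + b' = h) (hw : (a' = h ∧ b' = 0) ∨ (a' = 0 ∧ b' = h)) :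
    (a = 0 ∧ b = h) ∨ (a = h ∧ b = 0) := by
  omega

/-- **The polarisation powers never see the Weil line** (`h = 2n`): `θ^n` has bidegree `(n,n)`, and `(n,n) + (2n,0) ≠
(2n,2n)` unless `n = 0`.  So `⟨w, θ^n⟩ = 0` for every Weil class `w` and `n ≥ 1` — the reason the `χ = 1` term of
THEOREM Y dies after averaging (HECKE-G59 §3 LEMMA Y3 (b)).  [locator HECKE-G59 §3 LEMMA Y3]
research route, not a corollary; conditional on HC_CM plus one named minimal statement. -/
theorem lefschetz_orthogonal_to_weil (n : ℕ) (hn : 1 ≤ n) : ¬ (n + 2 * n = 2 * n ∧ n + 0 = 2 * n) := by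
  omega

end weilPart

section fourier

open ZMod

variable {N : ℕ} [NeZero N]

/-- **ASSEMBLY (iii): a function on `ℤ/N` with a non-zero spectrum is non-zero somewhere.**  Mathlib's discrete
Fourier transform `ZMod.dft` is a linear equivalence, so `b ≠ 0 ⟹ 𝓕 b ≠ 0 ⟹ ∃ t, 𝓕 b t ≠ 0`.  In THEOREM Y,
`F_w = Σ_χ F̂_w(χ)·χ` with `F̂_w ≠ 0` on the orbit `O₋`, hence some Schoen packet `Q_t` has `⟨ψ_*y_t, w⟩ ≠ 0`.
[locator HECKE-G59 §3 ASSEMBLY (iii)]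
research route, not a corollary; conditional on HC_CM plus one named minimal statement. -/
theorem exists_apply_ne_zero_of_spectrum_ne_zero (b : ZMod N → ℂ) (hb : b ≠ 0) :
    ∃ t : ZMod N, ZMod.dft b t ≠ 0 := by
  by_contra h
  push Not at h
  apply hb
  have h0 : ZMod.dft b = 0 := funext h
  exact (LinearEquiv.map_eq_zero_iff _).mp h0

/-- **ASSEMBLY (iii), contrapositive form used in the account:** if `𝓕 b` vanishes identically then `b = 0` — a
trigonometric polynomial `Σ_a b_a ζ^{−a t}` on `ℤ/N` that vanishes for all `t` has all coefficients zero.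
[locator HECKE-G59 §3 ASSEMBLY (iii)]
research route, not a corollary; conditional on HC_CM plus one named minimal statement. -/
theorem spectrum_eq_zero_of_forall_apply_eq_zero (b : ZMod N → ℂ) (h : ∀ t : ZMod N, ZMod.dft b t = 0) :
    b = 0 := by
  by_contra hb
  obtain ⟨t, ht⟩ := exists_apply_ne_zero_of_spectrum_ne_zero b hb
  exact ht (h t)

/-- **ASSEMBLY (i): the Weil parts of the `m` packets sum to zero.**  On `ℤ/N`, `𝓕 Φ 0 = Σ_j Φ j`
(`ZMod.dft_apply_zero`); in THEOREM Y the coefficient at the trivial character vanishes (LEMMA Y3 (b)), so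
`Σ_t F_w(t) = 0`.  [locator HECKE-G59 §2 THEOREM Y (i)]
research route, not a corollary; conditional on HC_CM plus one named minimal statement. -/
theorem sum_eq_zero_of_dft_zero (Φ : ZMod N → ℂ) (h : ZMod.dft Φ 0 = 0) : ∑ j : ZMod N, Φ j = 0 := by
  rwa [ZMod.dft_apply_zero] at h

end fourier

section exampleTwelve

/-! ### EXAMPLE Y″: the two headline non-split families at level `f = 12` (cells (4,1,[3]) and (4,3,[2]))

`G = ℤ/12 ⋊ ⟨u⟩` with `u = 5` (`K = ℚ(i)`, `H = ker χ_{−4} = {1,5}`) resp. `u = 7` (`K = ℚ(√−3)`, `H = {1,7}`); elements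
`x^a s` with `s x s⁻¹ = x^u`.  `(x^a s)² = x^{(1+u)a}`, conjugation by `x` sends `a ↦ a + (1 − u)`, by `s` sends `a ↦ u a`. -/

/-- **Involutions of `ℤ/12 ⋊ ⟨5⟩` outside `N`:** `x^a s` has order 2 iff `(1+5)a = 0` iff `a` is even.
[locator HECKE-G59 §5 (3)]  research route, not a corollary; conditional on HC_CM plus one named minimal statement. -/
theorem involutions_u5 : ∀ a : ZMod 12, (a + 5 * a = 0 ↔ 2 ∣ a.val) := by decide

/-- **Involutions of `ℤ/12 ⋊ ⟨7⟩` outside `N`:** `x^a s` has order 2 iff `(1+7)a = 0` iff `3 ∣ a`.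
[locator HECKE-G59 §5 (3)]  research route, not a corollary; conditional on HC_CM plus one named minimal statement. -/
theorem involutions_u7 : ∀ a : ZMod 12, (a + 7 * a = 0 ↔ 3 ∣ a.val) := by decide

/-- **The two involution classes of `ℤ/12 ⋊ ⟨5⟩` are `a ≡ 0` and `a ≡ 2 (mod 4)`:** conjugation (`a ↦ a + 8` by `x`,
`a ↦ 5a` by `s`) preserves `a mod 4` on involutions, and `a ↦ a + 8 ↦ a + 16 = a + 4` reaches every even `a′ ≡ a (4)`.
[locator HECKE-G59 §5 (3)]  research route, not a corollary; conditional on HC_CM plus one named minimal statement. -/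
theorem involution_classes_u5 :
    ∀ a : ZMod 12, a + 5 * a = 0 →
      ((4 ∣ (a + 8).val ↔ 4 ∣ a.val) ∧ (4 ∣ (5 * a).val ↔ 4 ∣ a.val) ∧
       ∀ a' : ZMod 12, a' + 5 * a' = 0 → ((4 ∣ a'.val ↔ 4 ∣ a.val) ↔
         (a' = a ∨ a' = a + 8 ∨ a' = a + 8 + 8 ∨ a' = 5 * a ∨ a' = 5 * a + 8 ∨ a' = 5 * a + 8 + 8))) := by
  decide

/-- **The two involution classes of `ℤ/12 ⋊ ⟨7⟩` are `a ≡ 0` and `a ≡ 3 (mod 6)`** (conjugation `a ↦ a + 6`, `a ↦ 7a`).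
[locator HECKE-G59 §5 (3)]  research route, not a corollary; conditional on HC_CM plus one named minimal statement. -/
theorem involution_classes_u7 :
    ∀ a : ZMod 12, a + 7 * a = 0 →
      ((6 ∣ (a + 6).val ↔ 6 ∣ a.val) ∧ (6 ∣ (7 * a).val ↔ 6 ∣ a.val) ∧
       ∀ a' : ZMod 12, a' + 7 * a' = 0 → ((6 ∣ a'.val ↔ 6 ∣ a.val) ↔
         (a' = a ∨ a' = a + 6 ∨ a' = 7 * a ∨ a' = 7 * a + 6))) := by
  decide

/-- **Coboundaries and the fixed-point criterion, `u = 5`:** `s` has a fixed point in the `ℤ/12`-torsor over `D_*`,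
i.e. `5t − c = t` is solvable, iff `c ∈ (u−1)·ℤ/12 = {0,4,8}` iff `4 ∣ c`.  [locator HECKE-G59 §5 (2)]
research route, not a corollary; conditional on HC_CM plus one named minimal statement. -/
theorem fixedPoint_criterion_u5 : ∀ c : ZMod 12, ((∃ t : ZMod 12, 5 * t - c = t) ↔ 4 ∣ c.val) := by decide

/-- **Coboundaries and the fixed-point criterion, `u = 7`:** `7t − c = t` is solvable iff `c ∈ {0,6}` iff `6 ∣ c`.
[locator HECKE-G59 §5 (2)]  research route, not a corollary; conditional on HC_CM plus one named minimal statement. -/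
theorem fixedPoint_criterion_u7 : ∀ c : ZMod 12, ((∃ t : ZMod 12, 7 * t - c = t) ↔ 6 ∣ c.val) := by decide

/-- **The headline class sums.**  (4,1,[3]) witness: eight involution-type branch points of classes `[s]⁷ [x²s]`, so
`Σ a_k ≡ 7·0 + 2 ≡ 2 (mod 4)`: NOT a coboundary — `s` fixes no Schoen component, `[τ] ≠ 0`.  (4,3,[2]) witness: classes
`[s]⁷ [x³s]`, `Σ a_k ≡ 3 (mod 6)`: `[τ] ≠ 0`.  Stated for arbitrary representatives `a_k` of the classes.
[locator HECKE-G59 §5 (3)]  research route, not a corollary; conditional on HC_CM plus one named minimal statement. -/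
theorem headline_class_sums :
    (∀ a : Fin 8 → ZMod 4, (∀ k, k ≠ 0 → a k = 0) → a 0 = 2 → ∑ k, a k = 2) ∧
    (∀ a : Fin 8 → ZMod 6, (∀ k, k ≠ 0 → a k = 0) → a 0 = 3 → ∑ k, a k = 3) := by
  refine ⟨fun a h h0 => ?_, fun a h h0 => ?_⟩ <;>
  · rw [Finset.sum_eq_single (0 : Fin 8) (fun k _ hk => h k hk) (fun hk => (hk (Finset.mem_univ _)).elim), h0]

/-- **The twisted-period exponent equation, `u = 5` (`K = ℚ(i)`):** `P_τ(t) = ζ^{a₁t}(1 + ζ^{a₁(τ + 4t)})` vanishes iff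
`τ + 4t = 6` in `ℤ/12` (`ζ^k = −1 ⟺ k = 6` for a primitive 12th root `ζ`, `a₁` odd).  For a cocycle value `τ = τ_s`
(`6τ = 0`): if `4 ∤ τ` (class `[τ] ≠ 0`) exactly FOUR `t` solve it — so 8 of the 12 packets carry Weil part; if `4 ∣ τ`
(`[τ] = 0`) NONE does — all 12 carry Weil part.  [locator HECKE-G59 §5 (4)]
research route, not a corollary; conditional on HC_CM plus one named minimal statement. -/
theorem twistedPeriod_zero_count_u5 :
    ∀ τ : ZMod 12, 6 * τ = 0 →
      (¬ 4 ∣ τ.val → (Finset.univ.filter fun t : ZMod 12 => τ + 4 * t = 6).card = 4) ∧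
      (4 ∣ τ.val → (Finset.univ.filter fun t : ZMod 12 => τ + 4 * t = 6).card = 0) := by
  decide

/-- **The twisted-period exponent equation, `u = 7` (`K = ℚ(√−3)`):** `P_τ(t) = ζ^{a₁t}(1 + ζ^{a₁(τ + 6t)})` vanishes
iff `τ + 6t = 6`.  For a cocycle value (`8τ = 0`, i.e. `3 ∣ τ`): if `6 ∤ τ` (`[τ] ≠ 0`) NO `t` solves it — all 12 packets
carry Weil part; if `6 ∣ τ` (`[τ] = 0`) exactly SIX do — 6 of 12 carry Weil part.  [locator HECKE-G59 §5 (4)]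
research route, not a corollary; conditional on HC_CM plus one named minimal statement. -/
theorem twistedPeriod_zero_count_u7 :
    ∀ τ : ZMod 12, 8 * τ = 0 →
      (¬ 6 ∣ τ.val → (Finset.univ.filter fun t : ZMod 12 => τ + 6 * t = 6).card = 0) ∧
      (6 ∣ τ.val → (Finset.univ.filter fun t : ZMod 12 => τ + 6 * t = 6).card = 6) := by
  decide

/-- **`ζ^k = −1 ⟺ k ≡ 6 (mod 12)` for a primitive 12th root of unity `ζ`** in a commutative ring without zero
divisors: the translation between the exponent equation above and the vanishing of `1 + ζ^k`.
[locator HECKE-G59 §5 (4)]  research route, not a corollary; conditional on HC_CM plus one named minimal statement. -/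
theorem pow_eq_neg_one_iff_twelve {R : Type*} [CommRing R] [IsDomain R] {ζ : R} (hζ : IsPrimitiveRoot ζ 12)
    (k : ℕ) : ζ ^ k = -1 ↔ k % 12 = 6 := by
  have h12 : ζ ^ 12 = 1 := hζ.pow_eq_one
  have h6 : ζ ^ 6 = -1 :=
    (hζ.pow (by norm_num) (by norm_num : 12 = 6 * 2)).eq_neg_one_of_two_right
  have hk : ζ ^ k = ζ ^ (k % 12) := by
    conv_lhs => rw [← Nat.div_add_mod k 12, pow_add, pow_mul, h12, one_pow, one_mul]
  constructor
  · intro h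
    rw [hk] at h
    have hlt : k % 12 < 12 := Nat.mod_lt _ (by norm_num)
    have heq : ζ ^ (k % 12) = ζ ^ 6 := by rw [h, h6]
    exact hζ.pow_inj hlt (by norm_num) heq
  · intro h
    rw [hk, h, h6]

end exampleTwelve

end Summit.HodgeConjecture.Ring2AbelianAll.HeckeNamedFourfolds
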